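import Summits.CriticalPhenomena.PercolationContinuityZ3.Theorems.SoloBlindSlitLadder
import HarnessLib

/-!
# The fin rung from one number: explicit statements

Seat `solo-CriticalPhenomena-blind`, toward `PercolationContinuityZ3` (`θ(p_c) = 0` on `ℤ³`).  This file
only UNFOLDS the criterion of `SoloBlindSlitRate` / `SoloBlindSlitLadder` into statements over tree
primitives, so that they can be read without the seat's intermediate definitions.

Let `P = P_{p_c(ℤ³)}` be critical bond percolation on `ℤ³`, `ℍ = {x : 0 ≤ x₀}`, and
`T₀ = Σ_{w ≠ 0} P(0 ↔ (0,0,w) inside ℍ)` (so `1 + T₀` is the expected number of sites of the boundary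
line `{(0,0,w)}` joined to the origin inside the critical half-space; numerically `T₀ ≈ 1.24`).

* `finRung_of_halfSpace_lineSum_le_two`: `T₀ ≤ 2 ⟹` the half-space with a half-plane glued along a
  boundary line, `ℤ³[{0 ≤ x₀} ∪ {x₁ = 0}]`, does not percolate at `p_c(ℤ³)` (the open rung `FinRung` of
  `SoloBlindOpenRungs`);
* `slitWall_of_halfSpace_lineSum_le_two`: `T₀ ≤ 2 ⟹` `ℤ³` with the plane `{x₀ = -1}` removed except for
  the line of sites `{(-1,0,w)}` does not percolate at `p_c(ℤ³)`, at any root, a.s. no infinite cluster;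
* `slitWall_of_percolationContinuityZ3`: the converse direction from the summit (the rung is below it).
The proof is the alternating BK chain bound across the slit with both sides copies of `ℍ` (reflection
`u ↦ (-1-u₀,u₁,u₂)`), contraction number `(p_c T₀)² < 1` from `p_c(ℤ³) < 1/2`
(`kesten_criticalProb_Z3_lt_half_holds`) and `T₀ ≤ 2`.
-/

noncomputable section

namespace Summit.CriticalPhenomena.PercolationContinuityZ3.Theorems

open MeasureTheory Literature.Probability.Percolation Literature.Probability.LatticeModels
open scoped ENNReal

/-- `T₀` unfolded: the off-diagonal half-space line sum at `p_c(ℤ³)`. -/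
theorem T0_eq :
    T0 = ∑' w : ℤ, Set.indicator {w : ℤ | w ≠ 0}
      (fun w => bondPercolation (zdGraph 3) (criticalProbI 3)
        (openConnVia (withinGraph (zdGraph 3) {x : Site 3 | 0 ≤ x 0}) 0 (Function.update 0 2 w))) w :=
  rfl

/-- **The fin rung from one number.** If `Σ_{w ≠ 0} P_{p_c}(0 ↔ (0,0,w) inside ℍ) ≤ 2` then
`θ_{ℤ³[{0 ≤ x₀} ∪ {x₁ = 0}]}(0, p_c(ℤ³)) = 0`. -/
theorem finRung_of_halfSpace_lineSum_le_two
    (h : ∑' w : ℤ, Set.indicator {w : ℤ | w ≠ 0}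
      (fun w => bondPercolation (zdGraph 3) (criticalProbI 3)
        (openConnVia (withinGraph (zdGraph 3) {x : Site 3 | 0 ≤ x 0}) 0 (Function.update 0 2 w))) w ≤ 2)
    (h0 : (0 : Site 3) ∈ {x : Site 3 | 0 ≤ x 0 ∨ x 1 = 0}) :
    theta ((zdGraph 3).induce {x : Site 3 | 0 ≤ x 0 ∨ x 1 = 0}) ⟨0, h0⟩ (criticalProbI 3) = 0 :=
  finRung_of_T0_le_two (by rw [T0_eq]; exact h) h0

/-- The slit wall region unfolded. -/
theorem slitRegion_one_eq :
    slitRegion 1 = {x : Site 3 | 0 ≤ x 0 ∨ (x 0 ≤ -2 ∨ (x 0 = -1 ∧ x 1 = 0))} := by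
  ext x
  simp only [slitRegion, hsp, slitZ, ZM, Set.mem_union, Set.mem_setOf_eq, Nat.cast_one, one_dvd,
    and_true]

/-- **The slit wall from one number.** If `Σ_{w ≠ 0} P_{p_c}(0 ↔ (0,0,w) inside ℍ) ≤ 2` then `ℤ³` with
the plane `{x₀ = -1}` removed except for the line `{(-1,0,w) : w ∈ ℤ}` has, `P_{p_c}`-a.s., no infinite
open cluster. -/
theorem slitWall_of_halfSpace_lineSum_le_two
    (h : ∑' w : ℤ, Set.indicator {w : ℤ | w ≠ 0}
      (fun w => bondPercolation (zdGraph 3) (criticalProbI 3)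
        (openConnVia (withinGraph (zdGraph 3) {x : Site 3 | 0 ≤ x 0}) 0 (Function.update 0 2 w))) w ≤ 2) :
    bondPercolation (zdGraph 3) (criticalProbI 3)
      (⋃ x ∈ {x : Site 3 | 0 ≤ x 0 ∨ (x 0 ≤ -2 ∨ (x 0 = -1 ∧ x 1 = 0))},
        percolatesVia (withinGraph (zdGraph 3)
          {x : Site 3 | 0 ≤ x 0 ∨ (x 0 ≤ -2 ∨ (x 0 = -1 ∧ x 1 = 0))}) x) = 0 := by
  rw [← slitRegion_one_eq]
  exact slit_noInfiniteCluster_of_T0_le_two (by rw [T0_eq]; exact h) 1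

/-- Conversely the slit wall rung lies below the summit: `θ(p_c) = 0` on `ℤ³` gives it for free. -/
theorem slitWall_of_percolationContinuityZ3 (h : Literature.Probability.Percolation.PercolationContinuityZ3)
    (x : Site 3) (hx : x ∈ {x : Site 3 | 0 ≤ x 0 ∨ (x 0 ≤ -2 ∨ (x 0 = -1 ∧ x 1 = 0))}) :
    theta ((zdGraph 3).induce {x : Site 3 | 0 ≤ x 0 ∨ (x 0 ≤ -2 ∨ (x 0 = -1 ∧ x 1 = 0))}) ⟨x, hx⟩
      (criticalProbI 3) = 0 := by
  have hx' : x ∈ slitRegion 1 := by rw [slitRegion_one_eq]; exact hx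
  have := theta_eq_zero_of_mem_slitPeriods
    (by rw [slitPeriods_eq_univ_of_percolationContinuityZ3 h]; trivial) x hx'
  rw [theta_induce_congr slitRegion_one_eq x hx'] at this
  exact this

end Summit.CriticalPhenomena.PercolationContinuityZ3.Theorems

end
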